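import Literature.AlgebraicGeometry.Motives.HodgeDecomposition
import Literature.Geometry.Kaehler.WedgeShuffleProofs
import Mathlib.Analysis.InnerProductSpace.PiL2
import HarnessLib

/-!
# Powers of the Kähler form on a unitary frame: `ωⁿ(e₁, Je₁, …, eₙ, Jeₙ) = n!` (Voisin I, Lemma 3.8)

Theorems-only companion of `Literature/AlgebraicGeometry/Motives/HodgeDecomposition.lean`
(`kaehlerFormPow g r = ω^r`, the wedge powers of the Kähler form `ω(v, w) = g(Jv, w)` of a Hermitian
metric, `Literature/Geometry/Kaehler/Kaehler.lean`) proving the pointwise linear algebra of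
C. Voisin, *Hodge Theory and Complex Algebraic Geometry I* (2002), §3.1.3, Lemma 3.8 ("The volume
form associated to a Hermitian metric `h` on `M` is equal to `ωⁿ/n!`"), whose printed proof is:
take a basis `e₁, …, eₙ` of `T_{M,m}` over `ℂ` with `h(eᵢ, eⱼ) = δᵢⱼ`; then `e₁, Ie₁, …, eₙ, Ieₙ` is a
real `g`-orthonormal basis and (eq. (3.2)) `(ωⁿ/n!)(e₁ ∧ Ie₁ ∧ ⋯ ∧ eₙ ∧ Ieₙ) = 1`.

## Main statements (all proved; no definitions)

* `kaehlerFormPow_apply_pairFrame`: for any Riemannian metric `g` on the real tangent bundle of a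
  complex manifold, any point `x` and vectors `uᵢ, wᵢ` with `ω(uᵢ, uⱼ) = 0`, `ω(wᵢ, wⱼ) = 0`,
  `ω(uᵢ, wⱼ) = δᵢⱼ` (`i, j < r`), the interleaved frame `(u₀, w₀, u₁, w₁, …)` satisfies
  **`ω^r_x(u₀, w₀, …, u_{r-1}, w_{r-1}) = r!`** — eq. (3.2). Proof (instead of Voisin's
  `ω = Σ dxᵢ ∧ dyᵢ`): induction on `r` through the subset shuffle formula
  `(ω^r ∧ ω)(f) = ∑_{a<b} ± ω^r(f without slots a, b) · ω(f_a, f_b)`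
  (`Literature.Geometry.Kaehler.wedge_apply_eq_sum_powersetCard`); on the interleaved frame
  `ω(f_a, f_b) = 0` unless `{a, b} = {2j, 2j+1}`, where the shuffle sign is `+1`
  (`sign_blockPerm_one_of_pairCompl`: that shuffle is the square of a cycle), `ω(uⱼ, wⱼ) = 1`, and the
  frame with the pair `j` deleted is again interleaved (value `r!` by induction); the `r + 1` pairs
  give `(r + 1)!`.
* `exists_basis_unitary`: a positive definite symmetric `J`-invariant real bilinear form `B` on a
  finite-dimensional complex vector space admits a complex basis `b` with `B(bᵢ, bⱼ) = δᵢⱼ` and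
  `B(i bᵢ, bⱼ) = 0` — a unitary basis of the Hermitian form `B + i B(i·, ·)` (Voisin's "basis with
  `h(eᵢ, eⱼ) = δᵢⱼ`"), from Mathlib's `stdOrthonormalBasis` of the inner product space built with
  `InnerProductSpace.ofCore`.
* `exists_basis_kaehlerFormPow_apply_eq_factorial`: for a **Hermitian** metric `g` and every point
  `x` there is a complex basis `b` of the model space with
  `ωⁿ_x(b₀, ib₀, …, b_{n-1}, ib_{n-1}) = n!`, `n = finrank ℂ E` — Voisin's (3.2) as printed.

The sequences `u`, `w` are indexed by `ℕ` and frames are written as explicit interleavings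
`fun i ↦ if i % 2 = 0 then u (i / 2) else w (i / 2)`, so that deleting a pair is a re-indexing and
no auxiliary definition is needed. Not here (sibling file `KaehlerVolumePositivityProofs.lean`):
`ωⁿ_x > 0` on every complex frame, `∫_M ωⁿ > 0`, and Voisin's Cor. 3.9 (`ω^k` is not exact).

## References

* C. Voisin, *Hodge Theory and Complex Algebraic Geometry I*, CUP (2002), §3.1.3, Lemma 3.8 and its
  proof, eq. (3.2) (PDF p. 63 of the held copy). [VoisinHodgeI2002]
-/

noncomputable section

open scoped Manifold
open Module ContinuousAlternatingMap Function Set.powersetCard Bundle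
open Literature.Geometry.Kaehler Literature.Geometry.Kaehler.HodgeStarAux

namespace Literature.AlgebraicGeometry.Motives

/-! ### The complement of an aligned pair `{2j, 2j+1}` in `Fin (2r + 2)` -/

section PairCompl

variable {r : ℕ}

/-- For `j ≤ r` there is a `2r`-subset of `Fin (2r + 2)` consisting of everything but `2j` and
`2j + 1` (the image of the increasing map skipping the pair). [folklore] -/
theorem exists_powersetCard_pairCompl (j : ℕ) (hj : j ≤ r) :
    ∃ s : Set.powersetCard (Fin (2 * r + 2)) (2 * r),
      ∀ x : Fin (2 * r + 2), x ∈ s ↔ (x : ℕ) ≠ 2 * j ∧ (x : ℕ) ≠ 2 * j + 1 := by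
  let f : Fin (2 * r) → Fin (2 * r + 2) := fun i ↦
    if (i : ℕ) < 2 * j then ⟨i, by omega⟩ else ⟨i + 2, by omega⟩
  have hf : ∀ i, ((f i : Fin (2 * r + 2)) : ℕ) = if (i : ℕ) < 2 * j then (i : ℕ) else i + 2 := by
    intro i
    simp only [f]
    split_ifs <;> rfl
  have hmono : StrictMono f := fun a b hab ↦ by
    have hab' : (a : ℕ) < b := hab
    change ((f a : Fin (2 * r + 2)) : ℕ) < (f b : Fin (2 * r + 2))
    rw [hf, hf]
    split_ifs <;> omega
  refine ⟨ofFinEmbEquiv (OrderEmbedding.ofStrictMono f hmono), fun x ↦ ?_⟩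
  rw [mem_ofFinEmbEquiv_iff_mem_range]
  change x ∈ Set.range f ↔ _
  constructor
  · rintro ⟨i, rfl⟩
    have h := hf i
    split_ifs at h with hi <;> omega
  · rintro ⟨h1, h2⟩
    by_cases hx : (x : ℕ) < 2 * j
    · refine ⟨⟨x, by omega⟩, Fin.ext ?_⟩
      rw [hf]
      simp [hx]
    · refine ⟨⟨x - 2, by omega⟩, Fin.ext ?_⟩
      rw [hf]
      dsimp only
      rw [if_neg (by omega)]
      omega

variable {j : ℕ} {s : Set.powersetCard (Fin (2 * r + 2)) (2 * r)}

/-- The pair index `j` is determined by the pair complement. [folklore] -/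
theorem eq_of_pairCompl {j' : ℕ} (hj : j ≤ r)
    (hs : ∀ x : Fin (2 * r + 2), x ∈ s ↔ (x : ℕ) ≠ 2 * j ∧ (x : ℕ) ≠ 2 * j + 1)
    (hs' : ∀ x : Fin (2 * r + 2), x ∈ s ↔ (x : ℕ) ≠ 2 * j' ∧ (x : ℕ) ≠ 2 * j' + 1) : j = j' := by
  have h1 : (⟨2 * j, by omega⟩ : Fin (2 * r + 2)) ∉ s := by
    rw [hs]
    simp
  rw [hs'] at h1
  push Not at h1
  by_cases h' : 2 * j = 2 * j'
  · omega
  · have := h1 h'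
    simp only at this
    omega

/-- The increasing enumeration of the complement of the pair `{2j, 2j+1}` is `i ↦ i` below `2j`
and `i ↦ i + 2` from `2j` on. [folklore] -/
theorem enum_val_of_pairCompl
    (hs : ∀ x : Fin (2 * r + 2), x ∈ s ↔ (x : ℕ) ≠ 2 * j ∧ (x : ℕ) ≠ 2 * j + 1) (i : Fin (2 * r)) :
    ((ofFinEmbEquiv.symm s i : Fin (2 * r + 2)) : ℕ) =
      if (i : ℕ) < 2 * j then (i : ℕ) else i + 2 := by
  let f : Fin (2 * r) → Fin (2 * r + 2) := fun i ↦
    if (i : ℕ) < 2 * j then ⟨i, by omega⟩ else ⟨i + 2, by omega⟩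
  have hf : ∀ i, ((f i : Fin (2 * r + 2)) : ℕ) = if (i : ℕ) < 2 * j then (i : ℕ) else i + 2 := by
    intro i
    simp only [f]
    split_ifs <;> rfl
  have hmono : StrictMono f := fun a b hab ↦ by
    have hab' : (a : ℕ) < b := hab
    change ((f a : Fin (2 * r + 2)) : ℕ) < (f b : Fin (2 * r + 2))
    rw [hf, hf]
    split_ifs <;> omega
  have hfs : ∀ i, f i ∈ (s : Finset (Fin (2 * r + 2))) := fun i ↦ by
    rw [Set.powersetCard.mem_coe_iff, hs, hf]
    split_ifs <;> omega
  have hu := Finset.orderEmbOfFin_unique s.prop hfs hmono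
  rw [ofFinEmbEquiv_symm_apply, ← hf i, hu]

/-- The increasing enumeration of the complementary `2`-subset `{2j, 2j+1}` takes the values `2j`,
`2j + 1`. [folklore] -/
theorem enum_compl_val_of_pairCompl
    (hs : ∀ x : Fin (2 * r + 2), x ∈ s ↔ (x : ℕ) ≠ 2 * j ∧ (x : ℕ) ≠ 2 * j + 1) (i : Fin 2) :
    ((ofFinEmbEquiv.symm (Set.powersetCard.compl (card_fin_add (k := 2 * r) (m := 2)) s) i :
      Fin (2 * r + 2)) : ℕ) = 2 * j + i := by
  set e := ofFinEmbEquiv.symm (Set.powersetCard.compl (card_fin_add (k := 2 * r) (m := 2)) s)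
    with he
  have hmem : ∀ i, ((e i : Fin (2 * r + 2)) : ℕ) = 2 * j ∨
      ((e i : Fin (2 * r + 2)) : ℕ) = 2 * j + 1 := by
    intro i
    have h := enum_mem (Set.powersetCard.compl (card_fin_add (k := 2 * r) (m := 2)) s) i
    rw [Set.powersetCard.mem_compl, hs] at h
    rw [← he] at h
    omega
  have hlt : e 0 < e 1 := e.strictMono (by decide)
  have hlt' : ((e 0 : Fin (2 * r + 2)) : ℕ) < (e 1 : Fin (2 * r + 2)) := hlt
  have h0 := hmem 0
  have h1 := hmem 1
  fin_cases i
  · simp only [Fin.zero_eta, Fin.isValue, add_zero]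
    omega
  · simp only [Fin.mk_one, Fin.isValue]
    omega

/-- **The shuffle `[e_s | e_{sᶜ}]` of the complement `s` of an aligned pair `{2j, 2j+1}` is even**:
it is the square of the cycle `ρ = (2j ↦ 2j+1 ↦ ⋯ ↦ 2r+1 ↦ 2j)` (moving an adjacent pair past a
block is an even permutation). [folklore] -/
theorem sign_blockPerm_one_of_pairCompl (hj : j ≤ r)
    (hs : ∀ x : Fin (2 * r + 2), x ∈ s ↔ (x : ℕ) ≠ 2 * j ∧ (x : ℕ) ≠ 2 * j + 1) :
    Equiv.Perm.sign (Equiv.ofBijective _ (blockMap_bijective s 1 1)) = 1 := by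
  let ρv : ℕ → ℕ := fun x ↦ if x < 2 * j then x else if x < 2 * r + 1 then x + 1 else 2 * j
  have hρv : ∀ x, x < 2 * r + 2 → ρv x < 2 * r + 2 := fun x hx ↦ by
    simp only [ρv]
    split_ifs <;> omega
  let ρf : Fin (2 * r + 2) → Fin (2 * r + 2) := fun i ↦ ⟨ρv i, hρv i i.2⟩
  have hinj : Injective ρf := by
    intro a b hab
    have h := congrArg Fin.val hab
    have ha := a.2
    have hb := b.2
    simp only [ρf, ρv] at h
    apply Fin.ext
    split_ifs at h <;> omega
  let ρ : Equiv.Perm (Fin (2 * r + 2)) := Equiv.ofBijective ρf hinj.bijective_of_finite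
  have hσ : Equiv.ofBijective _ (blockMap_bijective s 1 1) = ρ * ρ := by
    refine Equiv.ext fun i ↦ Fin.ext ?_
    induction i using Fin.addCases with
    | left i =>
      rw [blockPerm_one_apply_castAdd, enum_val_of_pairCompl hs]
      simp only [ρ, Equiv.Perm.mul_apply, Equiv.ofBijective_apply, ρf, ρv, Fin.val_castAdd]
      have hi := i.2
      split_ifs <;> omega
    | right i =>
      rw [blockPerm_one_apply_natAdd, enum_compl_val_of_pairCompl hs]
      simp only [ρ, Equiv.Perm.mul_apply, Equiv.ofBijective_apply, ρf, ρv, Fin.val_natAdd]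
      fin_cases i <;> split_ifs <;> omega
  rw [hσ, Equiv.Perm.sign_mul, Int.units_mul_self]

/-- Deleting the pair `j` from an interleaved frame `(u₀, w₀, u₁, w₁, …)` gives the interleaved frame
of the sequences with the index `j` deleted. [folklore] -/
theorem interleave_comp_enum_of_pairCompl {V : Type*}
    (hs : ∀ x : Fin (2 * r + 2), x ∈ s ↔ (x : ℕ) ≠ 2 * j ∧ (x : ℕ) ≠ 2 * j + 1) (u w : ℕ → V) :
    (fun i : Fin (2 * r + 2) ↦ if (i : ℕ) % 2 = 0 then u (i / 2) else w (i / 2)) ∘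
        ofFinEmbEquiv.symm s =
      fun i : Fin (2 * r) ↦ if (i : ℕ) % 2 = 0 then (if (i : ℕ) / 2 < j then u (i / 2) else u (i / 2 + 1))
        else (if (i : ℕ) / 2 < j then w (i / 2) else w (i / 2 + 1)) := by
  funext i
  rw [comp_apply, enum_val_of_pairCompl hs]
  by_cases hi : (i : ℕ) < 2 * j
  · rw [if_pos hi]
    have h1 : (i : ℕ) / 2 < j := by omega
    simp only [h1, if_true]
  · rw [if_neg hi]
    have h1 : ¬ (i : ℕ) / 2 < j := by omega
    have h2 : ((i : ℕ) + 2) % 2 = (i : ℕ) % 2 := by omega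
    have h3 : ((i : ℕ) + 2) / 2 = (i : ℕ) / 2 + 1 := by omega
    simp only [h1, if_false, h2, h3]

end PairCompl

/-- A `2`-form is antisymmetric: `β(x, y) = -β(y, x)`. [folklore] -/
theorem apply_vecCons_two_swap {V : Type*} [NormedAddCommGroup V] [NormedSpace ℝ V]
    (β : V [⋀^Fin 2]→L[ℝ] ℝ) (x y : V) : β ![x, y] = -β ![y, x] := by
  have h := AlternatingMap.map_swap β.toAlternatingMap ![y, x] (i := (0 : Fin 2)) (j := 1)
    (by decide)
  have hv : (![y, x] : Fin 2 → V) ∘ Equiv.swap (0 : Fin 2) 1 = ![x, y] := by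
    funext i
    fin_cases i <;> rfl
  rw [hv] at h
  simpa using h

/-! ### `ω^r` on an interleaved frame -/

section KaehlerFormPow

variable {E : Type*} [NormedAddCommGroup E] [NormedSpace ℂ E]
  {M : Type*} [TopologicalSpace M] [ChartedSpace E M]

/-- **Voisin's identity (3.2): `ω^r_x(u₀, w₀, …, u_{r-1}, w_{r-1}) = r!`** for the powers
`ω^r = kaehlerFormPow g r` of the Kähler form `ω` of a Riemannian metric `g` on the real tangent
bundle of a complex manifold, at a point `x`, on the interleaved frame of vectors `uᵢ, wᵢ` with
`ω(uᵢ, uⱼ) = 0`, `ω(wᵢ, wⱼ) = 0`, `ω(uᵢ, wⱼ) = δᵢⱼ` (`i, j < r`) — the relations of a unitary frame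
`eᵢ = uᵢ`, `Ieᵢ = wᵢ` of a Hermitian metric, for which this is
`(ωⁿ/n!)(e₁ ∧ Ie₁ ∧ ⋯ ∧ eₙ ∧ Ieₙ) = 1` (Voisin (2002), proof of Lemma 3.8, eq. (3.2)). Proof:
induction on `r` via the subset shuffle formula for `ω^r ∧ ω` (see the module docstring).
[cite: VoisinHodgeI2002, §3.1.3 Lemma 3.8, eq. (3.2)] -/
theorem kaehlerFormPow_apply_pairFrame (g : RiemannianMetric (fun x : M ↦ TangentSpace 𝓘(ℝ, E) x))
    (x : M) (r : ℕ) (u w : ℕ → E)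
    (huu : ∀ i j, i < r → j < r → g.kaehlerForm x ![u i, u j] = 0)
    (hww : ∀ i j, i < r → j < r → g.kaehlerForm x ![w i, w j] = 0)
    (huw : ∀ i j, i < r → j < r → g.kaehlerForm x ![u i, w j] = if i = j then 1 else 0) :
    kaehlerFormPow g r x (fun i : Fin (2 * r) ↦ if (i : ℕ) % 2 = 0 then u (i / 2) else w (i / 2)) =
      r.factorial := by
  induction r generalizing u w with
  | zero =>
    rw [Nat.factorial_zero, Nat.cast_one]
    rfl
  | succ r ih =>
    set β : E [⋀^Fin 2]→L[ℝ] ℝ := g.kaehlerForm x with hβdef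
    set α : E [⋀^Fin (2 * r)]→L[ℝ] ℝ := kaehlerFormPow g r x with hαdef
    -- the relations, with the vectors read in the model space `E`
    have huu' : ∀ i j, i < r + 1 → j < r + 1 → β (![u i, u j] : Fin 2 → E) = 0 := huu
    have hww' : ∀ i j, i < r + 1 → j < r + 1 → β (![w i, w j] : Fin 2 → E) = 0 := hww
    have huw' : ∀ i j, i < r + 1 → j < r + 1 →
        β (![u i, w j] : Fin 2 → E) = if i = j then 1 else 0 := huw
    rw [show kaehlerFormPow g (r + 1) x
        (fun i : Fin (2 * (r + 1)) ↦ if (i : ℕ) % 2 = 0 then u (i / 2) else w (i / 2)) =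
      α.wedge β (fun i : Fin (2 * r + 2) ↦ if (i : ℕ) % 2 = 0 then u (i / 2) else w (i / 2))
      from rfl]
    rw [wedge_apply_eq_sum_powersetCard]
    -- the pair complements, indexed by the pair
    have hex : ∀ jj : Fin (r + 1), ∃ s : Set.powersetCard (Fin (2 * r + 2)) (2 * r),
        ∀ x : Fin (2 * r + 2), x ∈ s ↔ (x : ℕ) ≠ 2 * (jj : ℕ) ∧ (x : ℕ) ≠ 2 * (jj : ℕ) + 1 :=
      fun jj ↦ exists_powersetCard_pairCompl (r := r) jj (Nat.le_of_lt_succ jj.2)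
    choose P hP using hex
    have hPinj : Injective P := fun j₁ j₂ h ↦ Fin.ext
      (eq_of_pairCompl (Nat.le_of_lt_succ j₁.2) (hP j₁) (by rw [h]; exact hP j₂))
    refine (Fintype.sum_of_injective P hPinj (fun _ ↦ (r.factorial : ℝ)) _ ?_ ?_).symm.trans ?_
    · -- subsets other than pair complements do not contribute
      intro s hs
      set e := ofFinEmbEquiv.symm (Set.powersetCard.compl (card_fin_add (k := 2 * r) (m := 2)) s)
        with he
      have hab : e 0 < e 1 := e.strictMono (by decide)
      have hab' : ((e 0 : Fin (2 * r + 2)) : ℕ) < (e 1 : Fin (2 * r + 2)) := hab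
      have h1lt := (e 1).2
      -- `{e 0, e 1}` is not an aligned pair `{2j, 2j+1}`, for then `s = P j`
      have hnot : ¬ (((e 0 : Fin (2 * r + 2)) : ℕ) % 2 = 0 ∧
          ((e 1 : Fin (2 * r + 2)) : ℕ) = (e 0 : Fin (2 * r + 2)) + 1) := by
        rintro ⟨h0, h1⟩
        apply hs
        -- `s` is the complement of the pair with index `(e 0) / 2`
        have hs' : ∀ y : Fin (2 * r + 2), y ∈ s ↔
            (y : ℕ) ≠ 2 * ((e 0 : Fin (2 * r + 2)) / 2) ∧
              (y : ℕ) ≠ 2 * ((e 0 : Fin (2 * r + 2)) / 2) + 1 := by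
          intro y
          constructor
          · intro hy
            have hyt : y ∉ Set.powersetCard.compl (card_fin_add (k := 2 * r) (m := 2)) s :=
              fun h ↦ Set.powersetCard.mem_compl.1 h hy
            rw [← mem_range_ofFinEmbEquiv_symm_iff_mem, ← he] at hyt
            have hy0 : y ≠ e 0 := fun h ↦ hyt ⟨0, h.symm⟩
            have hy1 : y ≠ e 1 := fun h ↦ hyt ⟨1, h.symm⟩
            rw [Ne, Fin.ext_iff] at hy0 hy1
            omega
          · rintro ⟨hy0, hy1⟩
            by_contra hys
            have hyt : y ∈ Set.powersetCard.compl (card_fin_add (k := 2 * r) (m := 2)) s :=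
              Set.powersetCard.mem_compl.2 hys
            rw [← mem_range_ofFinEmbEquiv_symm_iff_mem, ← he] at hyt
            obtain ⟨i, hi⟩ := hyt
            fin_cases i
            · have := congrArg Fin.val hi
              simp only [Fin.zero_eta, Fin.isValue] at this
              omega
            · have := congrArg Fin.val hi
              simp only [Fin.mk_one, Fin.isValue] at this
              omega
        refine ⟨⟨(e 0 : Fin (2 * r + 2)) / 2, by omega⟩, ?_⟩
        -- `P j = s` from the shared membership characterisation
        rw [Set.powersetCard.eq_iff_subset]
        intro y hy
        rw [Set.powersetCard.mem_coe_iff, hP] at hy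
        rw [Set.powersetCard.mem_coe_iff, hs']
        exact hy
      suffices h0 : β ((fun i : Fin (2 * r + 2) ↦ if (i : ℕ) % 2 = 0 then u (i / 2) else w (i / 2)) ∘ e)
          = 0 by
        rw [h0, mul_zero, smul_zero]
      rw [show ((fun i : Fin (2 * r + 2) ↦ if (i : ℕ) % 2 = 0 then u (i / 2) else w (i / 2)) ∘ e) =
        ![if ((e 0 : Fin (2 * r + 2)) : ℕ) % 2 = 0 then u ((e 0 : Fin (2 * r + 2)) / 2)
            else w ((e 0 : Fin (2 * r + 2)) / 2),
          if ((e 1 : Fin (2 * r + 2)) : ℕ) % 2 = 0 then u ((e 1 : Fin (2 * r + 2)) / 2)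
            else w ((e 1 : Fin (2 * r + 2)) / 2)] from funext fun i ↦ by fin_cases i <;> rfl]
      have hr0 : ((e 0 : Fin (2 * r + 2)) : ℕ) / 2 < r + 1 := by omega
      have hr1 : ((e 1 : Fin (2 * r + 2)) : ℕ) / 2 < r + 1 := by omega
      by_cases p0 : ((e 0 : Fin (2 * r + 2)) : ℕ) % 2 = 0 <;>
        by_cases p1 : ((e 1 : Fin (2 * r + 2)) : ℕ) % 2 = 0
      · rw [if_pos p0, if_pos p1]
        exact huu' _ _ hr0 hr1
      · rw [if_pos p0, if_neg p1, huw' _ _ hr0 hr1, if_neg]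
        omega
      · rw [if_neg p0, if_pos p1, apply_vecCons_two_swap, huw' _ _ hr1 hr0, if_neg, neg_zero]
        omega
      · rw [if_neg p0, if_neg p1]
        exact hww' _ _ hr0 hr1
    · -- the pair complement `P j` contributes `r!`
      intro jj
      have hjj := jj.2
      have hj : (jj : ℕ) ≤ r := Nat.le_of_lt_succ hjj
      set e := ofFinEmbEquiv.symm (Set.powersetCard.compl (card_fin_add (k := 2 * r) (m := 2))
        (P jj)) with he
      have hv0 : ((e 0 : Fin (2 * r + 2)) : ℕ) = 2 * jj := by
        have h := enum_compl_val_of_pairCompl (hP jj) 0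
        rw [← he] at h
        simpa using h
      have hv1 : ((e 1 : Fin (2 * r + 2)) : ℕ) = 2 * jj + 1 := by
        have h := enum_compl_val_of_pairCompl (hP jj) 1
        rw [← he] at h
        simpa using h
      have key : ∀ i : Fin 2,
          (fun i : Fin (2 * r + 2) ↦ if (i : ℕ) % 2 = 0 then u (i / 2) else w (i / 2)) (e i) =
            ![u jj, w jj] i := by
        rw [Fin.forall_fin_two]
        refine ⟨?_, ?_⟩
        · simp only [hv0, Fin.isValue, Matrix.cons_val_zero]
          rw [if_pos (by omega), show 2 * (jj : ℕ) / 2 = jj by omega]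
        · simp only [hv1, Fin.isValue, Matrix.cons_val_one, Matrix.cons_val_fin_one]
          rw [if_neg (by omega), show (2 * (jj : ℕ) + 1) / 2 = jj by omega]
      have hβ : β ((fun i : Fin (2 * r + 2) ↦ if (i : ℕ) % 2 = 0 then u (i / 2) else w (i / 2)) ∘ e) =
          β ![u jj, w jj] := congrArg β (funext key)
      rw [sign_blockPerm_one_of_pairCompl hj (hP jj), one_smul,
        interleave_comp_enum_of_pairCompl (hP jj), hβ, huw' _ _ hjj hjj, if_pos rfl,
        mul_one]
      -- the deleted frame is the interleaved frame of the re-indexed sequences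
      have hih := ih (fun i ↦ if i < jj then u i else u (i + 1))
        (fun i ↦ if i < jj then w i else w (i + 1)) ?_ ?_ ?_
      · exact hih.symm
      · intro i j hi hj'
        split_ifs <;> exact huu _ _ (by omega) (by omega)
      · intro i j hi hj'
        split_ifs <;> exact hww _ _ (by omega) (by omega)
      · intro i j hi hj'
        split_ifs <;> rw [huw _ _ (by omega) (by omega)] <;> split_ifs <;>
          first | rfl | (exfalso; omega)
    · rw [Finset.sum_const, Finset.card_univ, Fintype.card_fin, Nat.factorial_succ, nsmul_eq_mul]
      push_cast
      ring

end KaehlerFormPow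

/-! ### Unitary bases -/

section Unitary

open Complex

/-- **Unitary bases exist** (Voisin (2002), proof of Lemma 3.8: "Let `e₁, …, eₙ` be a basis of
`T_{M,m}` over `ℂ` such that `h(eᵢ, eⱼ) = δᵢⱼ`"). Let `B` be a real-bilinear, symmetric, positive
definite form on a finite-dimensional complex vector space `F` which is invariant under `J = i•`
(`B(iv, iw) = B(v, w)`: the real part of a Hermitian metric, Voisin §3.1.1). Then there is a complex
basis `b` of `F` with `B(bᵢ, bⱼ) = δᵢⱼ` and `B(i bᵢ, bⱼ) = 0`, i.e. orthonormal for the positive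
definite Hermitian form `h(v, w) = B(v, w) + i B(iv, w)` (conjugate-linear in `v`): Mathlib's
`stdOrthonormalBasis` of the inner product space `InnerProductSpace.ofCore h`. Real-bilinearity is
phrased with the complex scalars `(a : ℂ)`, `a : ℝ`, so that no real module structure on `F` is
mentioned. [cite: VoisinHodgeI2002, §3.1.3 Lemma 3.8 (proof)] -/
theorem exists_basis_unitary {F : Type*} [AddCommGroup F] [Module ℂ F] [FiniteDimensional ℂ F]
    (B : F → F → ℝ) (hadd : ∀ u v w, B (u + v) w = B u w + B v w)
    (hsmul : ∀ (a : ℝ) (v w : F), B ((a : ℂ) • v) w = a * B v w)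
    (hsymm : ∀ v w, B v w = B w v) (hpos : ∀ v, v ≠ 0 → 0 < B v v)
    (hJ : ∀ v w, B (I • v) (I • w) = B v w) :
    ∃ b : Module.Basis (Fin (finrank ℂ F)) ℂ F,
      (∀ i j, B (b i) (b j) = if i = j then 1 else 0) ∧ ∀ i j, B (I • b i) (b j) = 0 := by
  -- derived identities
  have hneg : ∀ v w, B (-v) w = -B v w := fun v w ↦ by
    have h := hsmul (-1) v w
    rw [show ((-1 : ℝ) : ℂ) = -1 by norm_num, neg_one_smul] at h
    rw [h]
    ring
  have hzero : ∀ w, B 0 w = 0 := fun w ↦ by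
    have h := hadd 0 0 w
    rw [add_zero] at h
    linarith
  have haddr : ∀ u v w, B u (v + w) = B u v + B u w := fun u v w ↦ by
    rw [hsymm, hadd, hsymm v, hsymm w]
  have hsmulr : ∀ (a : ℝ) (v w : F), B v ((a : ℂ) • w) = a * B v w := fun a v w ↦ by
    rw [hsymm, hsmul, hsymm]
  have hIleft : ∀ v w, B (I • v) w = -B v (I • w) := fun v w ↦ by
    have h := hJ v (I • w)
    rw [smul_smul, I_mul_I, neg_one_smul, hsymm (I • v) (-w), hneg, hsymm] at h
    linarith
  have hIself : ∀ v, B (I • v) v = 0 := fun v ↦ by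
    have h := hIleft v v
    rw [hsymm v (I • v)] at h
    linarith
  -- the Hermitian inner product `⟪v, w⟫ = B v w + i B(Iv, w)` (conjugate-linear in `v`)
  let c : InnerProductSpace.Core ℂ F :=
    { inner := fun v w ↦ ⟨B v w, B (I • v) w⟩
      conj_inner_symm := fun v w ↦ by
        apply Complex.ext
        · simp [hsymm]
        · simp only [conj_im]
          rw [hIleft, hsymm, neg_neg]
      re_inner_nonneg := fun v ↦ by
        show 0 ≤ B v v
        by_cases hv : v = 0
        · rw [hv, hzero]
        · exact (hpos v hv).le
      add_left := fun u v w ↦ by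
        apply Complex.ext
        · simp [hadd]
        · simp [smul_add, hadd]
      smul_left := fun v w r ↦ by
        have hr : r • v = (r.re : ℂ) • v + (r.im : ℂ) • (I • v) := by
          rw [smul_smul, ← add_smul, re_add_im]
        apply Complex.ext
        · simp only [mul_re, conj_re, conj_im]
          rw [hr, hadd, hsmul, hsmul]
          ring
        · simp only [mul_im, conj_re, conj_im]
          rw [hr, smul_add, smul_comm I (r.re : ℂ) v, smul_comm I (r.im : ℂ) (I • v), smul_smul I I v,
            I_mul_I, neg_one_smul, smul_neg, hadd, hsmul, hneg, hsmul]
          ring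
      definite := fun v hv ↦ by
        by_contra h
        have h1 := hpos v h
        have h2 := congrArg Complex.re hv
        simp only [zero_re] at h2
        linarith }
  letI : NormedAddCommGroup F := @InnerProductSpace.Core.toNormedAddCommGroup ℂ F _ _ _ c
  letI : InnerProductSpace ℂ F := InnerProductSpace.ofCore _
  let b := stdOrthonormalBasis ℂ F
  have hb : ∀ i j, (inner ℂ (b i) (b j) : ℂ) = if i = j then 1 else 0 := orthonormal_iff_ite.1 b.orthonormal
  have hb' : ∀ i j, (⟨B (b i) (b j), B (I • b i) (b j)⟩ : ℂ) = if i = j then 1 else 0 := hb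
  refine ⟨b.toBasis, fun i j ↦ ?_, fun i j ↦ ?_⟩
  · have h := congrArg Complex.re (hb' i j)
    rw [OrthonormalBasis.coe_toBasis]
    simp only at h
    rw [h]
    split_ifs <;> simp
  · have h := congrArg Complex.im (hb' i j)
    rw [OrthonormalBasis.coe_toBasis]
    simp only at h
    rw [h]
    split_ifs <;> simp

end Unitary

/-! ### Voisin's (3.2) at a point of a Hermitian manifold -/

section Hermitian

variable {E : Type*} [NormedAddCommGroup E] [NormedSpace ℂ E] [FiniteDimensional ℂ E]
  {M : Type*} [TopologicalSpace M] [ChartedSpace E M]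

/-- **Voisin (2002), Lemma 3.8, eq. (3.2), as printed**: for a Hermitian metric `g` on the real
tangent bundle of a complex manifold modelled on `E`, `n = dim_ℂ E`, and every point `x`, there is
a complex basis `b₀, …, b_{n-1}` of the model (= tangent) space — unitary for `h = g - iω` at `x` —
with `ωⁿ_x(b₀, ib₀, b₁, ib₁, …, b_{n-1}, ib_{n-1}) = n!`, where `ωⁿ = kaehlerFormPow g n` and
`ω(v, w) = g(Jv, w)` is the Kähler form. In particular `ωⁿ_x ≠ 0`. From `exists_basis_unitary` and
`kaehlerFormPow_apply_pairFrame`. [cite: VoisinHodgeI2002, §3.1.3 Lemma 3.8, eq. (3.2)] -/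
theorem exists_basis_kaehlerFormPow_apply_eq_factorial
    (g : RiemannianMetric (fun x : M ↦ TangentSpace 𝓘(ℝ, E) x)) (hg : g.IsHermitian) (x : M) :
    ∃ b : Module.Basis (Fin (finrank ℂ E)) ℂ E,
      kaehlerFormPow g (finrank ℂ E) x (fun i : Fin (2 * finrank ℂ E) ↦
        if (i : ℕ) % 2 = 0 then b ⟨(i : ℕ) / 2, by omega⟩
          else Complex.I • b ⟨(i : ℕ) / 2, by omega⟩) = (finrank ℂ E).factorial := by
  -- the metric at `x` as a real bilinear form on the model space `E = T_x M`
  set B : E →L[ℝ] E →L[ℝ] ℝ := g.inner x with hB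
  obtain ⟨b, hb1, hb2⟩ := exists_basis_unitary (F := E) (fun v w : E ↦ B v w)
    (fun u v w ↦ by rw [B.map_add]; rfl)
    (fun a v w ↦ by rw [show ((a : ℂ) • v : E) = a • v from rfl, B.map_smul]; rfl)
    (fun v w ↦ by exact g.symm x v w) (fun v hv ↦ by exact g.pos x v hv)
    (fun v w ↦ by exact hg x v w)
  refine ⟨b, ?_⟩
  have hBs : ∀ v w : E, B v w = B w v := fun v w ↦ by exact g.symm x v w
  have hBJ : ∀ v w : E, B (Complex.I • v) (Complex.I • w) = B v w := fun v w ↦ by exact hg x v w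
  have hω : ∀ v w : E, g.kaehlerForm x ![v, w] = B (Complex.I • v) w := fun v w ↦ by
    exact Bundle.RiemannianMetric.kaehlerForm_apply_of_isHermitian g hg x v w
  -- the unitary frame as `ℕ`-indexed sequences
  set u : ℕ → E := fun i ↦ if h : i < finrank ℂ E then b ⟨i, h⟩ else 0 with hu
  have hui : ∀ (i : ℕ) (h : i < finrank ℂ E), u i = b ⟨i, h⟩ := fun i h ↦ by simp [hu, h]
  have key := kaehlerFormPow_apply_pairFrame g x (finrank ℂ E) u (fun i ↦ Complex.I • u i)
    ?_ ?_ ?_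
  · rw [← key]
    congr 1
    funext i
    rw [hui ((i : ℕ) / 2) (by omega)]
  · intro i j hi hj
    rw [hω, hui i hi, hui j hj]
    exact hb2 _ _
  · intro i j hi hj
    rw [hω, smul_smul, Complex.I_mul_I, neg_one_smul, map_neg]
    show -(B (u i) (Complex.I • u j)) = 0
    rw [hBs, hui i hi, hui j hj, hb2, neg_zero]
  · intro i j hi hj
    rw [hω, hBJ, hui i hi, hui j hj, hb1]
    simp only [Fin.mk.injEq]

end Hermitian

end Literature.AlgebraicGeometry.Motives
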